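import Summits.QuantumFields.YangMills.Theorems.BalabanUVNodesN15KingModelThm33AtRegularFieldRegionDatumAlong

/-!
# Route «BalabanUVNodes», node N15 = NE2 — THE KING-MODEL RUNG, PART Θ⁺⁺-c: KING 1986 THEOREM 3.3 ON A BIG-BLOCK REGION `Ω ⊊ T_ε` AT A REGULAR
# BACKGROUND — THE FINE-LATTICE CLAUSES: (3.7) for `G_k(Ω, A)`, `D^η_{A,μ}G_k(Ω, A)`, (3.8), and the LIVE clauses for `δG_k(Ω, A) = G_k(Ω, A) − G_k(A)`

Cell `pub-ymgap`, Track A (D-0062), seat `pub-ymgap-dag-n15-e` (R141 (C), s3), generation 21; third file of PART Θ⁺⁺ (datum: `…RegionDatum`).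
`bears_on: R4∕N15`; `--supports stmt-QuantumFields-27366` (K3⁸, `--as helper`).  COUNT-NEUTRAL.  Namespace `…N15KingModelRung.Curved`.

WHAT THIS FILE PROVES (0 `sorry`, no `def`).  ★★ `region_fine_clauses`: for `d ≥ 1`, `L` odd `> 1`, `a, m² > 0`, `N`, `(e, q)` there are `K₀min` and, for
every cube size `K₀ ≥ K₀min`, a threshold `t > 0` such that for every torus of the carrier with `K₀ ∣ M`, `3K₀ ≤ 2M`, every level `1 ≤ k < K_P` with
`L^kε ≤ 1`, every big-block union `Ω`, every field `A` with one-step differences `≤ δ`, `L^k·δ·|e| ≤ t`, there are `C₁, δ₁ > 0` such that for all `C ≥ C₁`,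
`0 < δ₀ ≤ δ₁` and EVERY fine carrier `V` and admissible contour system `Γ` (`IsAdm y x (Γ y x)`), the datum `D = kingThm33DataAlong C P k Ω V Γ A a m²` satisfies the six fine-lattice bounds of
`ContinuumLimit.Thm33Printed` at `α = ½` AT THE POINTS OF `V` IN THE `R₀`-INTERIOR `intSet k K₀ Ω` (pointwise form; PART Θ⁺⁺-d takes `V = intSet`):
(3.7) `Decay37` for `D.G` and every `D.DG μ`, (3.8) `Holder38 … ½ C δ₀ (D.DG μ)`, and the three LIVE `δG` clauses (value, covariant derivative, Hölder
quotient of the derivative) with the additional factor `exp[−δ₀ dist({x,y}, ∂Ω) − δ₀ dist(supp f, ∂Ω)]`.  SOURCES, BY NAME (p35, [Ba1] Prop. 2.1 under the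
`R₀`-condition at a regular field, `c_reg = 1`, `β = 1`, `ε₀ = 1`): (3.7) ⇐ `B1Ineq225RegularRegion.norm_propagatorK_region_reg_decay_sum`,
`B1Ineq225DerivRegularRegion.norm_covDeriv_propagatorK_region_reg_decay_sum` ((2.25)); (3.8) ⇐ `B1Ineq224RegularRegion.norm_holder_propagatorK_region_reg_decay_sum`
((2.24), `α = ½`); the `δG` clauses ⇐ `B1Ineq226RegularRegionSum.deltaG_region_reg_decay_sum`, `B1Ineq226HolderRegularRegion.holder_deltaG_region_reg_decay_sum`
((2.26) with `Ω ⊂ Ω₀ = T_ε`), rates `1∕(4K₀)` resp. `1∕(8K₀)` per `L^k` fine steps.  [cite: King1986, Thm 3.3 (3.7)–(3.8) p.656]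
[cite: Balaban1982Higgs1, Prop. 2.1 (2.24)–(2.26) p.610] [cite: Balaban1983RegularityDecay, Theorem (1.9)–(1.12) p.573]

HONEST FRAMING ∕ SCOPE.  A KNIT; no estimate is new; hypotheses and scope exactly as in `…RegionDatum`: THE `R₀`-INTERIOR READING (observation points and
sources at distance `≥ R₀` from `Ωᶜ` — [Ba1]∕[Ba4]'s printed restriction; King's parallelepiped waiver NOT used), tori with `K₀ ∣ M`, `3K₀ ≤ 2M`, `m² > 0`,
`1 ≤ k < K_P`, `L^kε ≤ 1`, constants existential per `K₀`.  NOT Bałaban's non-abelian `G(U)`; NE2⁺ NOT printed ∕ not proved; NOT a node discharge;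
counts untouched; nothing continuum ∕ ℝ⁴ ∕ OS ∕ mass-gap ∕ Clay.
-/

noncomputable section

open scoped BigOperators

namespace Summit.QuantumFields.YangMills.BalabanUVNodes.N15KingModelRung.Curved

open Literature.MathematicalPhysics.QuantumFieldTheory.Balaban1983to89
open Literature.MathematicalPhysics.QuantumFieldTheory.Balaban1983to89.HiggsLattice (ChargeData covDeriv)
open Literature.MathematicalPhysics.QuantumFieldTheory.Balaban1983to89.HiggsCovariance (propagatorK)
open Literature.MathematicalPhysics.QuantumFieldTheory.Balaban1983to89.B1Eq230FluctCov (Ix)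
open Literature.MathematicalPhysics.QuantumFieldTheory.Balaban1983to89.B1TorusChainTransport (hol)
open Literature.MathematicalPhysics.QuantumFieldTheory.Balaban1983to89.B3Ineq211RegularTorus (IsAdm one_le_tdist_of_ne')
open Literature.MathematicalPhysics.QuantumFieldTheory.Balaban1983to89.B1TorusCubeCover (half)
open Literature.MathematicalPhysics.QuantumFieldTheory.Balaban1983to89.B1TorusCubeLocality26 (rS)
open Literature.MathematicalPhysics.QuantumFieldTheory.Balaban1983to89.B1TorusRegionHSizes (IsBigBlockUnion isBigBlockUnion_univ)
open Literature.MathematicalPhysics.QuantumFieldTheory.Balaban1983to89.B1TorusRegionRop (chi)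
open Literature.MathematicalPhysics.QuantumFieldTheory.Balaban1983to89.B1Ineq225BackgroundTorus (three_half_le_sites)
open Literature.MathematicalPhysics.QuantumFieldTheory.Balaban1983to89.B1Ineq225RegularRegion (norm_propagatorK_region_reg_decay_sum)
open Literature.MathematicalPhysics.QuantumFieldTheory.Balaban1983to89.B1Ineq225DerivRegularRegion (norm_covDeriv_propagatorK_region_reg_decay_sum)
open Literature.MathematicalPhysics.QuantumFieldTheory.Balaban1983to89.B1Ineq224RegularRegion (norm_holder_propagatorK_region_reg_decay_sum)
open Literature.MathematicalPhysics.QuantumFieldTheory.Balaban1983to89.B1Ineq226RegularRegionSum (deltaG_region_reg_decay_sum)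
open Literature.MathematicalPhysics.QuantumFieldTheory.Balaban1983to89.B1Ineq226HolderRegularRegion (holder_deltaG_region_reg_decay_sum)
open Literature.MathematicalPhysics.QuantumFieldTheory.King1986.ContinuumLimit (Thm33Data Thm33Printed Decay37 Holder38)

variable {N : ℕ}

set_option maxHeartbeats 400000 in
/-- ★★ **THE FINE-LATTICE CLAUSES OF KING 1986 THEOREM 3.3 ON A BIG-BLOCK REGION AT A REGULAR BACKGROUND** — (3.7) for `G_k(Ω, A)` and
`D^η_{A,μ}G_k(Ω, A)`, (3.8) at `α = ½`, and the three LIVE `δG_k(Ω, A)` clauses with the factor `exp[−δ₀ dist({x,y}, ∂Ω) − δ₀ dist(supp f, ∂Ω)]`, for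
the datum `kingThm33DataAlong C P k Ω V Γ A a m²` (any fine carrier `V`, any admissible contour system `Γ`, any `D` equal to it) AT THE `R₀`-INTERIOR POINTS of `V`, with constants monotone-ready (`∀ C ≥ C₁, 0 < δ₀ ≤ δ₁`) for the assembly of PART Θ⁺⁺-d
(statement and sources in the module docstring). [cite: King1986, Thm 3.3 (3.7)–(3.8) p.656] [cite: Balaban1982Higgs1, Prop. 2.1 (2.24)–(2.26) p.610]
[cite: Balaban1983RegularityDecay, Theorem (1.9)–(1.12) p.573] -/
theorem region_fine_clauses (d L : ℕ) (hd : 1 ≤ d) (hL : Odd L ∧ 1 < L) {a msq : ℝ} (ha : 0 < a) (hmsq : 0 < msq) (N : ℕ) (C : ChargeData N) :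
    ∃ K₀min : ℕ, ∀ K₀ : ℕ, K₀min ≤ K₀ → ∃ t : ℝ, 0 < t ∧
      ∀ (P : HiggsLattice.Params), P.d = d → P.L = L → K₀ ∣ P.M → 3 * K₀ ≤ 2 * P.M →
      ∀ {k : ℕ}, 1 ≤ k → k < P.K → P.mesh k ≤ 1 →
      ∀ (Ω : Finset (HiggsLattice.Site P 0)), IsBigBlockUnion k K₀ Ω → ∀ (V : Finset (HiggsLattice.Site P 0)),
      ∀ (Γ : HiggsLattice.Site P 0 → HiggsLattice.Site P 0 → List (HiggsLattice.Site P 0)), (∀ y x, IsAdm y x (Γ y x)) →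
      ∀ (A : HiggsLattice.VecField P 0) {δ : ℝ}, 0 ≤ δ →
        (∀ (z : HiggsLattice.Site P 0) (μ ν : Fin P.d), |A ⟨z.shift ν, μ⟩ - A ⟨z, μ⟩| ≤ δ) →
        (P.L : ℝ) ^ k * δ * |C.e| ≤ t →
        ∃ C₁ δ₁ : ℝ, 0 < C₁ ∧ 0 < δ₁ ∧ ∀ (Cc δ₀ : ℝ), C₁ ≤ Cc → 0 < δ₀ → δ₀ ≤ δ₁ →
        ∀ D : Thm33Data P.d (USite k Ω) (VSite V) (EuclideanSpace ℝ (Fin N)), D = kingThm33DataAlong C P k Ω V Γ A a msq →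
          (∀ f x, x.1 ∈ intSet k K₀ Ω → ‖D.G f x‖ ≤ Cc * Real.exp (-(δ₀ * D.dsupp f x)) * D.supNorm f) ∧
          (∀ μ f x, x.1 ∈ intSet k K₀ Ω → ‖D.DG μ f x‖ ≤ Cc * Real.exp (-(δ₀ * D.dsupp f x)) * D.supNorm f) ∧
          (∀ μ f x y, x ≠ y → x.1 ∈ intSet k K₀ Ω → y.1 ∈ intSet k K₀ Ω →
            (D.distη x y) ^ (-(1 / 2 : ℝ)) * ‖D.transport y x (D.DG μ f x) - D.DG μ f y‖
              ≤ Cc * Real.exp (-(δ₀ * D.dsupp2 f x y)) * D.supNorm f) ∧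
          (∀ f x, x.1 ∈ intSet k K₀ Ω → ‖D.δG f x‖ ≤ Cc * Real.exp (-(δ₀ * D.dsupp f x)) * D.supNorm f
              * Real.exp (-(δ₀ * D.dbdryη x x) - δ₀ * D.dsuppbdry f)) ∧
          (∀ μ f x, x.1 ∈ intSet k K₀ Ω → ‖D.δDG μ f x‖ ≤ Cc * Real.exp (-(δ₀ * D.dsupp f x)) * D.supNorm f
              * Real.exp (-(δ₀ * D.dbdryη x x) - δ₀ * D.dsuppbdry f)) ∧
          (∀ μ f x y, x ≠ y → x.1 ∈ intSet k K₀ Ω → y.1 ∈ intSet k K₀ Ω →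
            (D.distη x y) ^ (-(1 / 2 : ℝ)) * ‖D.transport y x (D.δDG μ f x) - D.δDG μ f y‖
              ≤ Cc * Real.exp (-(δ₀ * D.dsupp2 f x y)) * D.supNorm f
                * Real.exp (-(δ₀ * D.dbdryη x y) - δ₀ * D.dsuppbdry f)) := by
  have hL2 : 2 ≤ L := hL.2
  obtain ⟨K₁, hV⟩ := norm_propagatorK_region_reg_decay_sum d L hd hL2 ha hmsq N C 1 1 1 zero_le_one one_pos
  obtain ⟨K₂, hD⟩ := norm_covDeriv_propagatorK_region_reg_decay_sum d L hd hL2 ha hmsq N C 1 1 1 zero_le_one one_pos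
  obtain ⟨K₃, hH0⟩ := norm_holder_propagatorK_region_reg_decay_sum d L hd hL2 ha hmsq N C 1 1 1 zero_le_one one_pos
  obtain ⟨K₄, hδV0⟩ := deltaG_region_reg_decay_sum d L hd hL2 ha hmsq N C 1 1 1 zero_le_one one_pos
  obtain ⟨K₅, hδH0⟩ := holder_deltaG_region_reg_decay_sum d L hd hL2 ha hmsq N C 1 1 1 zero_le_one one_pos
  refine ⟨max (max (max K₁ K₂) (max K₃ K₄)) (max K₅ 1), fun K₀ hK₀ => ?_⟩
  obtain ⟨⟨⟨hK₁, hK₂⟩, hK₃, hK₄⟩, hK₅, hK₀1⟩ : ((K₁ ≤ K₀ ∧ K₂ ≤ K₀) ∧ K₃ ≤ K₀ ∧ K₄ ≤ K₀) ∧ K₅ ≤ K₀ ∧ 1 ≤ K₀ := by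
    simp only [max_le_iff] at hK₀; exact hK₀
  obtain ⟨cV, eV, hcV, heV, hV'⟩ := hV K₀ hK₁
  obtain ⟨cD, eD, hcD, heD, hD'⟩ := hD K₀ hK₂
  obtain ⟨cH, eH, hcH, heH, hH'⟩ := hH0 (α := 1 / 2) (by norm_num) (by norm_num) K₀ hK₃
  obtain ⟨cδ, eδ, hcδ, heδ, hδV'⟩ := hδV0 K₀ hK₄
  obtain ⟨cδH, eδH, hcδH, heδH, hδH'⟩ := hδH0 (α := 1 / 2) (by norm_num) (by norm_num) K₀ hK₅
  clear hV hD hH0 hδV0 hδH0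
  have hK₀r : (0 : ℝ) < K₀ := by exact_mod_cast hK₀1
  -- the threshold
  obtain ⟨t, htdef⟩ : ∃ t : ℝ, t = min eV (min eD (min eH (min eδ eδH))) := ⟨_, rfl⟩
  have htpos : 0 < t := by rw [htdef]; exact lt_min heV (lt_min heD (lt_min heH (lt_min heδ heδH)))
  refine ⟨t, htpos, ?_⟩
  intro P hPd hPL hK₀M h3M k hk1 hkK hs Ω hΩbig V Γ hΓ A δ hδ hreg ht
  obtain ⟨j, rfl⟩ : ∃ j, k = j + 1 := ⟨k - 1, by omega⟩
  have ht' : ∀ u, t ≤ u → (P.L : ℝ) ^ (j + 1) * δ * |C.e| ≤ u := fun u hu => ht.trans hu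
  have htV := ht' eV (by rw [htdef]; exact min_le_left _ _)
  have htD := ht' eD (by rw [htdef]; exact (min_le_right _ _).trans (min_le_left _ _))
  have htH := ht' eH (by rw [htdef]; exact (min_le_right _ _).trans ((min_le_right _ _).trans (min_le_left _ _)))
  have htδ := ht' eδ (by
    rw [htdef]; exact (min_le_right _ _).trans ((min_le_right _ _).trans ((min_le_right _ _).trans (min_le_left _ _))))
  have htδH := ht' eδH (by
    rw [htdef]; exact (min_le_right _ _).trans ((min_le_right _ _).trans ((min_le_right _ _).trans (min_le_right _ _))))
  have hLpos : (0 : ℝ) < (P.L : ℝ) := by exact_mod_cast P.hL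
  have hLk : (0 : ℝ) < (P.L : ℝ) ^ (j + 1) := pow_pos hLpos _
  have hmesh : 0 < P.mesh (j + 1) := P.mesh_pos _
  have hN3 : ∀ μ, 3 * half P (j + 1) K₀ ≤ P.sitesPerDir 0 μ := fun μ => three_half_le_sites hkK.le h3M μ
  -- p35's regularity currency at `c = 1`, `β = 1`, `e_k := e₁`
  have hreg35 : ∀ {e₁ : ℝ}, 0 < e₁ → (P.L : ℝ) ^ (j + 1) * δ * |C.e| ≤ e₁ →
      ∀ (x : HiggsLattice.Site P 0) (μ ν : Fin P.d),
        P.mesh (j + 1) * |C.e| / e₁ * |A ⟨x.shift μ, ν⟩ - A ⟨x, ν⟩| ≤ 1 * e₁ ^ ((1 : ℝ) - 1) / (P.L : ℝ) ^ (j + 1) := by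
    intro e₁ he₁ hte x μ ν
    rw [sub_self, Real.rpow_zero, mul_one]
    have h1 : P.mesh (j + 1) * |C.e| / e₁ * |A ⟨x.shift μ, ν⟩ - A ⟨x, ν⟩| ≤ P.mesh (j + 1) * |C.e| / e₁ * δ :=
      mul_le_mul_of_nonneg_left (hreg x ν μ) (by positivity)
    refine h1.trans ?_
    rw [div_mul_eq_mul_div, div_le_div_iff₀ he₁ hLk, one_mul]
    have h2 : P.mesh (j + 1) * |C.e| * δ * (P.L : ℝ) ^ (j + 1) = P.mesh (j + 1) * ((P.L : ℝ) ^ (j + 1) * δ * |C.e|) := by ring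
    rw [h2]
    calc P.mesh (j + 1) * ((P.L : ℝ) ^ (j + 1) * δ * |C.e|) ≤ 1 * e₁ := mul_le_mul hs hte (by positivity) zero_le_one
      _ = e₁ := one_mul _
  have hregΩ : ∀ {e₁ : ℝ}, 0 < e₁ → (P.L : ℝ) ^ (j + 1) * δ * |C.e| ≤ e₁ →
      ∀ z ∈ Ω, ∀ (μ ν : Fin P.d),
        P.mesh (j + 1) * |C.e| / e₁ * |A ⟨z.shift μ, ν⟩ - A ⟨z, ν⟩| ≤ 1 * e₁ ^ ((1 : ℝ) - 1) / (P.L : ℝ) ^ (j + 1) :=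
    fun he hte z _ μ ν => hreg35 he hte z μ ν
  have hregU : ∀ {e₁ : ℝ}, 0 < e₁ → (P.L : ℝ) ^ (j + 1) * δ * |C.e| ≤ e₁ →
      ∀ z ∈ (Finset.univ : Finset (HiggsLattice.Site P 0)), ∀ (μ ν : Fin P.d),
        P.mesh (j + 1) * |C.e| / e₁ * |A ⟨z.shift μ, ν⟩ - A ⟨z, ν⟩| ≤ 1 * e₁ ^ ((1 : ℝ) - 1) / (P.L : ℝ) ^ (j + 1) :=
    fun he hte z _ μ ν => hreg35 he hte z μ ν
  have hV'' := hV' P hPd hPL hK₀M hk1 hkK.le hN3 hs Ω hΩbig A heV le_rfl (hregΩ heV htV)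
  have hD'' := hD' P hPd hPL hK₀M hk1 hkK.le hN3 hs Ω hΩbig A heD le_rfl (hregΩ heD htD)
  have hH'' := hH' P hPd hPL hK₀M hk1 hkK.le hN3 hs Ω hΩbig A heH le_rfl (hregΩ heH htH)
  have hδV'' := hδV' P hPd hPL hK₀M hk1 hkK.le hN3 hs Ω Finset.univ hΩbig isBigBlockUnion_univ (Finset.subset_univ _) A heδ le_rfl
    (hregU heδ htδ)
  have hδH'' := hδH' P hPd hPL hK₀M hk1 hkK.le hN3 hs Ω Finset.univ hΩbig isBigBlockUnion_univ (Finset.subset_univ _) A heδH le_rfl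
    (hregU heδH htδH)
  clear hV' hD' hH' hδV' hδH' hreg35 hregΩ hregU
  -- the interior hypotheses of the datum's sites; source bookkeeping
  have hint : ∀ x : VSite V, x.1 ∈ intSet (j + 1) K₀ Ω → ∀ y,
      HiggsLattice.Site.tdist x.1 y ≤ 2 * rS P (j + 1) K₀ + 2 * half P (j + 1) K₀ * (P.d + 1) + 1 → y ∈ Ω :=
    fun x hx y hy => mem_intSet.1 hx y hy
  have hint' : ∀ x : VSite V, x.1 ∈ intSet (j + 1) K₀ Ω → ∀ y,
      HiggsLattice.Site.tdist x.1 y ≤ 2 * rS P (j + 1) K₀ + 2 * half P (j + 1) K₀ * (P.d + 1) → y ∈ Ω :=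
    fun x hx y hy => mem_intSet.1 hx y (hy.trans (Nat.le_succ _))
  have hgM : ∀ (f : VSite V → EuclideanSpace ℝ (Fin N)) (y : HiggsLattice.Site P 0), ‖extI f y‖ ≤ ‖f‖ :=
    fun f y => norm_extI_le f y
  have hgD : ∀ (f : VSite V → EuclideanSpace ℝ (Fin N)) (x : VSite V) (z : HiggsLattice.Site P 0),
      extI f z ≠ 0 → sdistI x f ≤ (HiggsLattice.Site.tdist x.1 z : ℝ) := by
    intro f x z hz
    obtain ⟨hz', hfz⟩ := extI_ne_zero hz
    exact sdistI_le (z := ⟨z, hz'⟩) hfz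
  have hgD₁ : ∀ (f : VSite V → EuclideanSpace ℝ (Fin N)) (y z : HiggsLattice.Site P 0),
      extI f y ≠ 0 → z ∉ Ω → sbdistI Ω f ≤ (HiggsLattice.Site.tdist z y : ℝ) := by
    intro f y z hy hz
    obtain ⟨hy', hfy⟩ := extI_ne_zero hy
    exact sbdistI_le (z := ⟨y, hy'⟩) hfy hz
  have hrate4 : ∀ D : ℝ, Real.exp (-(D / (4 * K₀ * (P.L : ℝ) ^ (j + 1)))) = Real.exp (-(1 / (4 * K₀) * (D / (P.L : ℝ) ^ (j + 1)))) :=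
    fun D => exp_rate_region (by norm_num) hK₀r.ne' hLk.ne' D
  have hrate8 : ∀ D : ℝ, Real.exp (-(D / (8 * K₀ * (P.L : ℝ) ^ (j + 1)))) = Real.exp (-(1 / (8 * K₀) * (D / (P.L : ℝ) ^ (j + 1)))) :=
    fun D => exp_rate_region (by norm_num) hK₀r.ne' hLk.ne' D
  -- the constants
  refine ⟨cV + cD + cH + cδ + cδH, 1 / (8 * K₀), by positivity, by positivity, ?_⟩
  rintro Cc δ₀ hCc hδ₀pos hδ₀_8 D rfl
  have hCc0 : 0 ≤ Cc := by linarith only [hCc, hcV.le, hcD.le, hcH.le, hcδ.le, hcδH.le]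
  have hcV_le : cV ≤ Cc := by linarith only [hCc, hcD.le, hcH.le, hcδ.le, hcδH.le]
  have hcD_le : cD ≤ Cc := by linarith only [hCc, hcV.le, hcH.le, hcδ.le, hcδH.le]
  have hcH_le : cH ≤ Cc := by linarith only [hCc, hcV.le, hcD.le, hcδ.le, hcδH.le]
  have hcδ_le : cδ ≤ Cc := by linarith only [hCc, hcV.le, hcD.le, hcH.le, hcδH.le]
  have hcδH_le : cδH ≤ Cc := by linarith only [hCc, hcV.le, hcD.le, hcH.le, hcδ.le]
  have hδ₀_4 : δ₀ ≤ 1 / (4 * K₀) :=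
    hδ₀_8.trans (one_div_le_one_div_of_le (by positivity) (by linarith only [hK₀r]))
  refine ⟨?_, ?_, ?_, ?_, ?_, ?_⟩
  · -- (3.7) `G_k(Ω, A)`
    intro f x hxI
    show ‖(P.mesh (j + 1) ^ 2)⁻¹ • propagatorK C Ω A msq a (j + 1) (chi Ω • extI f) x.1‖
        ≤ Cc * Real.exp (-(δ₀ * (sdistI x f / (P.L : ℝ) ^ (j + 1)))) * ‖f‖
    have hb := hV'' x.1 (hint' x hxI) (extI f) ‖f‖ (sdistI x f) (hgM f) (sdistI_nonneg x f) (fun z hz => hgD f x z hz)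
    rw [hrate4] at hb
    rw [norm_smul, Real.norm_of_nonneg (inv_nonneg.2 (sq_nonneg _))]
    have hs0 : 0 ≤ sdistI x f / (P.L : ℝ) ^ (j + 1) := div_nonneg (sdistI_nonneg x f) hLk.le
    exact (inv_meshsq_mul_le_of_le' hmesh hb).trans (weight_mono_region hcV_le hCc0 hδ₀_4 hs0 (norm_nonneg _))
  · -- (3.7) `D^η_{A,μ}G_k(Ω, A)`
    intro μ f x hxI
    show ‖(P.mesh (j + 1))⁻¹ • covDeriv C A (propagatorK C Ω A msq a (j + 1) (chi Ω • extI f)) ⟨x.1, μ⟩‖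
        ≤ Cc * Real.exp (-(δ₀ * (sdistI x f / (P.L : ℝ) ^ (j + 1)))) * ‖f‖
    have hb := hD'' x.1 μ (hint x hxI) (extI f) ‖f‖ (sdistI x f) (hgM f) (sdistI_nonneg x f) (fun z hz => hgD f x z hz)
    rw [hrate4] at hb
    rw [norm_smul, Real.norm_of_nonneg (inv_nonneg.2 hmesh.le)]
    have hs0 : 0 ≤ sdistI x f / (P.L : ℝ) ^ (j + 1) := div_nonneg (sdistI_nonneg x f) hLk.le
    exact (inv_mesh_mul_le_of_le' hmesh hb).trans (weight_mono_region hcD_le hCc0 hδ₀_4 hs0 (norm_nonneg _))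
  · -- (3.8)
    intro μ f x y hxy hxI hyI
    have hxy' : x.1 ≠ y.1 := fun h => hxy (Subtype.ext h)
    show ((HiggsLattice.Site.tdist x.1 y.1 : ℝ) / (P.L : ℝ) ^ (j + 1)) ^ (-(1 / 2 : ℝ)) *
          ‖hol C A y.1 (Γ y.1 x.1) ((P.mesh (j + 1))⁻¹ • covDeriv C A (propagatorK C Ω A msq a (j + 1) (chi Ω • extI f)) ⟨x.1, μ⟩)
            - (P.mesh (j + 1))⁻¹ • covDeriv C A (propagatorK C Ω A msq a (j + 1) (chi Ω • extI f)) ⟨y.1, μ⟩‖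
        ≤ Cc * Real.exp (-(δ₀ * (min (sdistI x f) (sdistI y f) / (P.L : ℝ) ^ (j + 1)))) * ‖f‖
    obtain ⟨hch, hend, hlen⟩ := hΓ y.1 x.1
    have hb := hH'' μ y.1 x.1 hxy' (hint y hyI) (hint x hxI) (Γ y.1 x.1) hch hend hlen (extI f) ‖f‖ (min (sdistI x f) (sdistI y f))
      (hgM f) (le_min (sdistI_nonneg x f) (sdistI_nonneg y f))
      (fun z hz => (min_le_right _ _).trans (hgD f y z hz))
      (fun z hz => (min_le_left _ _).trans (hgD f x z hz))
    rw [hrate4] at hb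
    rw [clm_smul_sub, norm_smul, Real.norm_of_nonneg (inv_nonneg.2 hmesh.le)]
    have htpos : 0 < (HiggsLattice.Site.tdist x.1 y.1 : ℝ) / (P.L : ℝ) ^ (j + 1) := by
      have h1 : (1 : ℝ) ≤ (HiggsLattice.Site.tdist x.1 y.1 : ℝ) := by
        exact_mod_cast one_le_tdist_of_ne' (P := P) (x := x.1) (x' := y.1) (Ne.symm hxy')
      positivity
    have hpow : ((HiggsLattice.Site.tdist x.1 y.1 : ℝ) / (P.L : ℝ) ^ (j + 1)) ^ (-(1 / 2 : ℝ))
        = (((HiggsLattice.Site.tdist y.1 x.1 : ℝ) / (P.L : ℝ) ^ (j + 1))⁻¹) ^ (1 / 2 : ℝ) := by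
      rw [tdist_comm y.1 x.1, Real.rpow_neg htpos.le, Real.inv_rpow htpos.le]
    rw [hpow, mul_left_comm ((((HiggsLattice.Site.tdist y.1 x.1 : ℝ) / (P.L : ℝ) ^ (j + 1))⁻¹) ^ (1 / 2 : ℝ)) ((P.mesh (j + 1))⁻¹)]
    have hs0 : 0 ≤ min (sdistI x f) (sdistI y f) / (P.L : ℝ) ^ (j + 1) :=
      div_nonneg (le_min (sdistI_nonneg x f) (sdistI_nonneg y f)) hLk.le
    exact (inv_mesh_mul_le_of_le' hmesh hb).trans (weight_mono_region hcH_le hCc0 hδ₀_4 hs0 (norm_nonneg _))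
  · -- `δG_k(Ω, A)` — LIVE: (2.26) value member
    intro f x hxI
    show ‖(P.mesh (j + 1) ^ 2)⁻¹ • (propagatorK C Ω A msq a (j + 1) (chi Ω • extI f)
            - propagatorK C Finset.univ A msq a (j + 1) (chi (Finset.univ : Finset (HiggsLattice.Site P 0)) • extI f)) x.1‖
        ≤ Cc * Real.exp (-(δ₀ * (sdistI x f / (P.L : ℝ) ^ (j + 1)))) * ‖f‖ *
          Real.exp (-(δ₀ * (min (bdistΩ Ω x.1) (bdistΩ Ω x.1) / (P.L : ℝ) ^ (j + 1))) - δ₀ * (sbdistI Ω f / (P.L : ℝ) ^ (j + 1)))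
    have hb := (hδV'' x.1 (hint x hxI) (extI f) ‖f‖ (sdistI x f) (bdistΩ Ω x.1) (sbdistI Ω f) (hgM f) (sdistI_nonneg x f)
      (bdistΩ_nonneg Ω x.1) (sbdistI_nonneg Ω f) (fun z hz => hgD f x z hz)
      (fun z hz => bdistΩ_le x.1 hz) (fun y' z hy hz => hgD₁ f y' z hy hz)).1
    rw [hrate8, add_div, add_div] at hb
    rw [min_self, norm_smul, Real.norm_of_nonneg (inv_nonneg.2 (sq_nonneg _))]
    have hs0 : 0 ≤ sdistI x f / (P.L : ℝ) ^ (j + 1) := div_nonneg (sdistI_nonneg x f) hLk.le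
    have hu : 0 ≤ bdistΩ Ω x.1 / (P.L : ℝ) ^ (j + 1) := div_nonneg (bdistΩ_nonneg Ω x.1) hLk.le
    have hv : 0 ≤ sbdistI Ω f / (P.L : ℝ) ^ (j + 1) := div_nonneg (sbdistI_nonneg Ω f) hLk.le
    have e1 := exp_split3_region hδ₀_8 hs0 hu hv
    refine (inv_meshsq_mul_le_of_le' hmesh hb).trans ?_
    calc cδ * Real.exp (-(1 / (8 * K₀) * (sdistI x f / (P.L : ℝ) ^ (j + 1) + bdistΩ Ω x.1 / (P.L : ℝ) ^ (j + 1)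
            + sbdistI Ω f / (P.L : ℝ) ^ (j + 1)))) * ‖f‖
        ≤ Cc * (Real.exp (-(δ₀ * (sdistI x f / (P.L : ℝ) ^ (j + 1)))) *
            Real.exp (-(δ₀ * (bdistΩ Ω x.1 / (P.L : ℝ) ^ (j + 1))) - δ₀ * (sbdistI Ω f / (P.L : ℝ) ^ (j + 1)))) * ‖f‖ :=
          mul_le_mul_of_nonneg_right (mul_le_mul hcδ_le e1 (Real.exp_nonneg _) hCc0) (norm_nonneg _)
      _ = _ := by ring
  · -- `D^η_{A,μ}δG_k(Ω, A)` — LIVE: (2.26) derivative member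
    intro μ f x hxI
    show ‖(P.mesh (j + 1))⁻¹ • covDeriv C A (propagatorK C Ω A msq a (j + 1) (chi Ω • extI f)
            - propagatorK C Finset.univ A msq a (j + 1) (chi (Finset.univ : Finset (HiggsLattice.Site P 0)) • extI f)) ⟨x.1, μ⟩‖
        ≤ Cc * Real.exp (-(δ₀ * (sdistI x f / (P.L : ℝ) ^ (j + 1)))) * ‖f‖ *
          Real.exp (-(δ₀ * (min (bdistΩ Ω x.1) (bdistΩ Ω x.1) / (P.L : ℝ) ^ (j + 1))) - δ₀ * (sbdistI Ω f / (P.L : ℝ) ^ (j + 1)))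
    have hb := (hδV'' x.1 (hint x hxI) (extI f) ‖f‖ (sdistI x f) (bdistΩ Ω x.1) (sbdistI Ω f) (hgM f) (sdistI_nonneg x f)
      (bdistΩ_nonneg Ω x.1) (sbdistI_nonneg Ω f) (fun z hz => hgD f x z hz)
      (fun z hz => bdistΩ_le x.1 hz) (fun y' z hy hz => hgD₁ f y' z hy hz)).2 μ
    rw [hrate8, add_div, add_div] at hb
    rw [min_self, norm_smul, Real.norm_of_nonneg (inv_nonneg.2 hmesh.le)]
    have hs0 : 0 ≤ sdistI x f / (P.L : ℝ) ^ (j + 1) := div_nonneg (sdistI_nonneg x f) hLk.le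
    have hu : 0 ≤ bdistΩ Ω x.1 / (P.L : ℝ) ^ (j + 1) := div_nonneg (bdistΩ_nonneg Ω x.1) hLk.le
    have hv : 0 ≤ sbdistI Ω f / (P.L : ℝ) ^ (j + 1) := div_nonneg (sbdistI_nonneg Ω f) hLk.le
    have e1 := exp_split3_region hδ₀_8 hs0 hu hv
    refine (inv_mesh_mul_le_of_le' hmesh hb).trans ?_
    calc cδ * Real.exp (-(1 / (8 * K₀) * (sdistI x f / (P.L : ℝ) ^ (j + 1) + bdistΩ Ω x.1 / (P.L : ℝ) ^ (j + 1)
            + sbdistI Ω f / (P.L : ℝ) ^ (j + 1)))) * ‖f‖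
        ≤ Cc * (Real.exp (-(δ₀ * (sdistI x f / (P.L : ℝ) ^ (j + 1)))) *
            Real.exp (-(δ₀ * (bdistΩ Ω x.1 / (P.L : ℝ) ^ (j + 1))) - δ₀ * (sbdistI Ω f / (P.L : ℝ) ^ (j + 1)))) * ‖f‖ :=
          mul_le_mul_of_nonneg_right (mul_le_mul hcδ_le e1 (Real.exp_nonneg _) hCc0) (norm_nonneg _)
      _ = _ := by ring
  · -- Hölder clause of `D^η_{A,μ}δG_k(Ω, A)` — LIVE: (2.26) with (2.24)
    intro μ f x y hxy hxI hyI
    have hxy' : x.1 ≠ y.1 := fun h => hxy (Subtype.ext h)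
    show ((HiggsLattice.Site.tdist x.1 y.1 : ℝ) / (P.L : ℝ) ^ (j + 1)) ^ (-(1 / 2 : ℝ)) *
          ‖hol C A y.1 (Γ y.1 x.1) ((P.mesh (j + 1))⁻¹ • covDeriv C A (propagatorK C Ω A msq a (j + 1) (chi Ω • extI f)
              - propagatorK C Finset.univ A msq a (j + 1) (chi (Finset.univ : Finset (HiggsLattice.Site P 0)) • extI f)) ⟨x.1, μ⟩)
            - (P.mesh (j + 1))⁻¹ • covDeriv C A (propagatorK C Ω A msq a (j + 1) (chi Ω • extI f)
              - propagatorK C Finset.univ A msq a (j + 1) (chi (Finset.univ : Finset (HiggsLattice.Site P 0)) • extI f)) ⟨y.1, μ⟩‖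
        ≤ Cc * Real.exp (-(δ₀ * (min (sdistI x f) (sdistI y f) / (P.L : ℝ) ^ (j + 1)))) * ‖f‖ *
          Real.exp (-(δ₀ * (min (bdistΩ Ω x.1) (bdistΩ Ω y.1) / (P.L : ℝ) ^ (j + 1))) - δ₀ * (sbdistI Ω f / (P.L : ℝ) ^ (j + 1)))
    obtain ⟨hch, hend, hlen⟩ := hΓ y.1 x.1
    have hb := hδH'' μ y.1 x.1 hxy' (hint y hyI) (hint x hxI) (Γ y.1 x.1) hch hend hlen (extI f) ‖f‖
      (min (sdistI x f) (sdistI y f)) (min (bdistΩ Ω x.1) (bdistΩ Ω y.1)) (sbdistI Ω f) (hgM f)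
      (le_min (sdistI_nonneg x f) (sdistI_nonneg y f)) (le_min (bdistΩ_nonneg Ω x.1) (bdistΩ_nonneg Ω y.1)) (sbdistI_nonneg Ω f)
      (fun z hz => (min_le_right _ _).trans (hgD f y z hz))
      (fun z hz => (min_le_left _ _).trans (hgD f x z hz))
      (fun z hz => (min_le_right _ _).trans (bdistΩ_le y.1 hz)) (fun z hz => (min_le_left _ _).trans (bdistΩ_le x.1 hz))
      (fun y' z hy hz => hgD₁ f y' z hy hz)
    rw [hrate8, add_div, add_div] at hb
    rw [clm_smul_sub, norm_smul, Real.norm_of_nonneg (inv_nonneg.2 hmesh.le)]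
    have htpos : 0 < (HiggsLattice.Site.tdist x.1 y.1 : ℝ) / (P.L : ℝ) ^ (j + 1) := by
      have h1 : (1 : ℝ) ≤ (HiggsLattice.Site.tdist x.1 y.1 : ℝ) := by
        exact_mod_cast one_le_tdist_of_ne' (P := P) (x := x.1) (x' := y.1) (Ne.symm hxy')
      positivity
    have hpow : ((HiggsLattice.Site.tdist x.1 y.1 : ℝ) / (P.L : ℝ) ^ (j + 1)) ^ (-(1 / 2 : ℝ))
        = (((HiggsLattice.Site.tdist y.1 x.1 : ℝ) / (P.L : ℝ) ^ (j + 1))⁻¹) ^ (1 / 2 : ℝ) := by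
      rw [tdist_comm y.1 x.1, Real.rpow_neg htpos.le, Real.inv_rpow htpos.le]
    rw [hpow, mul_left_comm ((((HiggsLattice.Site.tdist y.1 x.1 : ℝ) / (P.L : ℝ) ^ (j + 1))⁻¹) ^ (1 / 2 : ℝ)) ((P.mesh (j + 1))⁻¹)]
    have hs₁ : 0 ≤ min (sdistI x f) (sdistI y f) / (P.L : ℝ) ^ (j + 1) :=
      div_nonneg (le_min (sdistI_nonneg x f) (sdistI_nonneg y f)) hLk.le
    have hs₂ : 0 ≤ min (bdistΩ Ω x.1) (bdistΩ Ω y.1) / (P.L : ℝ) ^ (j + 1) :=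
      div_nonneg (le_min (bdistΩ_nonneg Ω x.1) (bdistΩ_nonneg Ω y.1)) hLk.le
    have hs₃ : 0 ≤ sbdistI Ω f / (P.L : ℝ) ^ (j + 1) := div_nonneg (sbdistI_nonneg Ω f) hLk.le
    have e1 := exp_split3_region hδ₀_8 hs₁ hs₂ hs₃
    refine (inv_mesh_mul_le_of_le' hmesh hb).trans ?_
    calc cδH * Real.exp (-(1 / (8 * K₀) * (min (sdistI x f) (sdistI y f) / (P.L : ℝ) ^ (j + 1)
            + min (bdistΩ Ω x.1) (bdistΩ Ω y.1) / (P.L : ℝ) ^ (j + 1) + sbdistI Ω f / (P.L : ℝ) ^ (j + 1)))) * ‖f‖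
        ≤ Cc * (Real.exp (-(δ₀ * (min (sdistI x f) (sdistI y f) / (P.L : ℝ) ^ (j + 1)))) *
            Real.exp (-(δ₀ * (min (bdistΩ Ω x.1) (bdistΩ Ω y.1) / (P.L : ℝ) ^ (j + 1))) - δ₀ * (sbdistI Ω f / (P.L : ℝ) ^ (j + 1)))) * ‖f‖ :=
          mul_le_mul_of_nonneg_right (mul_le_mul hcδH_le e1 (Real.exp_nonneg _) hCc0) (norm_nonneg _)
      _ = _ := by ring

end Summit.QuantumFields.YangMills.BalabanUVNodes.N15KingModelRung.Curved

end
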